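import Literature.NumberTheory.Sieve.ParityWave0
import Literature.NumberTheory.Sieve.MaynardTao
import HarnessLib

/-!
# Polymath 8b: `DHL[k, j]`, the `ε`-enlarged sieve functional `M_{k,ε}`, and `H₁ ≤ 246`

Trunk: AntSieve / parity.S13.  Decomposition of the named fact
`Literature.NumberTheory.Sieve.frequently_nth_prime_succ_le_add_polymath` (`liminf (p_{n+1} - p_n) ≤ 246`;
D. H. J. Polymath, *Variants of the Selberg sieve, and bounded intervals containing many primes*,
Res. Math. Sci. 1:12 (2014) = arXiv:1407.4897, Theorem 1.4(i)) into the sub-results of the printed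
proof (page numbers refer to the arXiv version):

* Thm 1.4(i) `H₁ ≤ 246` follows from `DHL[50, 2]` (Thm 3.2(i)) and `H(50) ≤ 246` (Thm 3.3(i)) by the
  remark "`DHL[k, m+1]` implies `H_m ≤ H(k)`" (p. 8);
* `DHL[50, 2]` follows from the Bombieri–Vinogradov theorem (Thm 2.3: `EH[θ]` for all `θ < 1/2`),
  the `ε`-enlarged multidimensional Selberg sieve (Thm 3.12(i): `EH[θ]`, `1 + ε < 1/θ` and
  `M_{k,ε} > 2m/θ` give `DHL[k, m+1]`; proved in §5.3, pp. 21–23) and the numerical bound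
  `M_{50,1/25} > 4.0043` (Thm 3.13(i); a degree-27 polynomial optimisation, §7.2, p. 31), with any
  `θ < 1/2` such that `2/θ < 4.0043` and `1.04 < 1/θ` (p. 11);
* `H(50) ≤ 246` is witnessed by the admissible 50-tuple displayed in §10.1 (p. 39; Clark–Jarvis), also
  printed in Granville, Bull. AMS 52 (2015) = arXiv:1410.8400, p. 6.

## Contents

* `WeakDicksonHardyLittlewood k j` = `DHL[k, j]` (Claim 3.1, p. 8), phrased with `∃ᶠ n in atTop`
  and the prime count of `frequently_card_primes_ge_of_maynardFunctional` (`MaynardTao.lean`), so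
  that Maynard's theorem (Polymath 8b Thm 3.8) reads `weakDHL_of_maynardFunctional_gt` (proved
  from that named fact).
* `scaledSimplex k r = r • R_k`, `polymathI k F = I(F)`, `polymathJ k r i F = J_{i,r}(F)`,
  `polymathFunctional k ε F = (∑ᵢ J_{i,1-ε}(F)) / I(F)`, `IsPolymathTestFunction k ε F`, and
  `polymathM k ε = M_{k,ε}` (Thm 3.12, p. 11).
* Named facts (NOT proved here): `weakDHL_of_polymathFunctional_gt` (Thm 3.12(i)) and
  `exists_polymathFunctional_fifty_gt` (Thm 3.13(i)).
* Proved: `narrowTuple50` is an admissible 50-tuple of diameter 246 (`decide`, Thm 3.3(i) upper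
  bound); `WeakDicksonHardyLittlewood.frequently_nth_prime_add_le` (`DHL[k, m+1]` and an admissible
  `k`-tuple of diameter `≤ d` give `p_{n+m} ≤ p_n + d` infinitely often, p. 8);
  `weakDHL_fifty_two` (`DHL[50, 2]` from `BombieriVinogradovStatement` and the two named facts);
  `Parity.frequently_nth_prime_succ_le_add_polymath_of_weakDHL` and
  `Parity.frequently_nth_prime_succ_le_add_polymath_of_bombieriVinogradovStatement` (Thm 1.4(i) from
  the three leaves).  The discharge `frequently_nth_prime_succ_le_add_polymath_holds` therefore reduces
  to `BombieriVinogradovStatement` (equivalently Wave0's parity.S27 `Parity.bombieri_vinogradov`, by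
  `Parity.bombieriVinogradovStatement_of_bombieri_vinogradov` in `ParityWave0Proofs.lean`), Thm 3.12(i)
  and Thm 3.13(i).

## Design notes

* **`J_{i,r}` on `Fin k → ℝ`.**  Polymath integrate `(∫₀^∞ F dt_i)²` over
  `(t_j)_{j ≠ i} ∈ r • R_{k-1}`.  As in `maynardJ` we keep all `k` coordinates: the integrand
  `(∫_{u > 0} F(t with t_i := u) du)²` does not depend on `t_i`, and we integrate it over
  `polymathJRegion k r i = {t | 0 ≤ t_i ≤ 1, t_j ≥ 0, ∑_{j ≠ i} t_j ≤ r}`, whose `t_i`-fibre is the unit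
  interval; by Fubini this is the printed `(k-1)`-fold integral on the nose, for every `r`.
* **`I(F)`** is the integral of `F²` over the orthant `[0,+∞)^k` (the domain of `F` in print).
* **Test functions.**  Thm 3.12 takes the supremum over square-integrable `F` supported on
  `(1+ε) • R_k` and not a.e. zero; `IsPolymathTestFunction` asks `F` measurable, `support F ⊆
  (1+ε) • R_k`, `F²` integrable there and `I(F) > 0` (same rendering as `IsMaynardAdmissible`).
* **`EH[θ]`.**  As in `frequently_card_primes_ge_of_maynardFunctional` (the tree's rendering of
  Thm 3.8), the hypothesis `EH[θ]` of Thm 3.12(i) is rendered by `PrimesHaveLevel θ`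
  (`LevelOfDistribution.lean`: level `x^{θ-ε'}` for every `ε' > 0`, Iwaniec–Kowalski Thm 17.1 shape),
  and `M_{k,ε} > 2m/θ` is rendered `sSup`-free by an explicit test function.  Both printed
  hypotheses `1 + ε < 1/θ`, `M_{k,ε} > 2m/θ` are open in `θ`, so the rendering follows from the
  printed theorem applied at a slightly smaller `θ`; Bombieri–Vinogradov enters as
  `BombieriVinogradovStatement : ∀ θ < 1/2, PrimesHaveLevel θ`.
* `polymathM` is a bare `sSup` (junk value `0` on an empty or unbounded set); no theorem is routed
  through it except the remark `le_polymathM` with an explicit `BddAbove` hypothesis.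
* Only the upper bound `H(50) ≤ 246` of Thm 3.3(i) is vendored (the tuple); the equality
  (Clark–Jarvis, exhaustive search) is not needed.

## References

* D. H. J. Polymath, *Variants of the Selberg sieve, and bounded intervals containing many primes*,
  Res. Math. Sci. 1 (2014), Art. 12; arXiv:1407.4897. [Polymath8b2014]
* J. Maynard, *Small gaps between primes*, Ann. of Math. 181 (2015), 383–413. [MaynardAnnals2015]
* A. Granville, *Primes in intervals of bounded length*, Bull. Amer. Math. Soc. 52 (2015), 171–222;
  arXiv:1410.8400 (the 50-tuple on p. 6). [Granville2014]
-/

noncomputable section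

open MeasureTheory Filter Finset
open scoped BigOperators

namespace Literature.NumberTheory.Sieve

/-! ### The weak Dickson–Hardy–Littlewood claim `DHL[k, j]` -/

/-- **Polymath 8b, Claim 3.1** (`DHL[k, j]`, the weak Dickson–Hardy–Littlewood conjecture, after
Pintz): for every admissible `k`-tuple `H = (h₁, …, h_k)` there are infinitely many translates
`n + H` containing at least `j` primes.  "Infinitely many `n`" is `∃ᶠ n : ℕ in atTop`, and the number of
primes among `n + h₁, …, n + h_k` is written exactly as in
`frequently_card_primes_ge_of_maynardFunctional`. [cite: Polymath8b2014, Claim 3.1] -/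
def WeakDicksonHardyLittlewood (k j : ℕ) : Prop :=
  ∀ (H : Finset ℤ), IsAdmissibleTuple H → H.card = k →
    ∃ᶠ n : ℕ in atTop, j ≤ #(H.filter fun h ↦ 0 < (n : ℤ) + h ∧ ((n : ℤ) + h).toNat.Prime)

/-- `DHL[k, j]` is monotone in `j`: fewer primes are easier (Polymath 8b §3, implicit). [folklore] -/
theorem WeakDicksonHardyLittlewood.mono {k j j' : ℕ} (h : WeakDicksonHardyLittlewood k j)
    (hj : j' ≤ j) : WeakDicksonHardyLittlewood k j' :=
  fun H hH hk => (h H hH hk).mono fun _ hn => hj.trans hn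

/-- `DHL[k, 1]` holds for every `k ≥ 1` (Euclid: one prime in a translate is free); recorded as a
non-vacuity check of the definition. [folklore] -/
theorem weakDHL_one {k : ℕ} (hk : 1 ≤ k) : WeakDicksonHardyLittlewood k 1 := by
  intro H _hH hcard
  obtain ⟨h₀, hh₀⟩ : H.Nonempty := Finset.card_pos.1 (by omega)
  refine Filter.frequently_atTop.2 fun N => ?_
  obtain ⟨p, hp, hprime⟩ := Nat.exists_infinite_primes (N + h₀.natAbs + 1)
  refine ⟨((p : ℤ) - h₀).toNat, by omega, Finset.one_le_card.2 ⟨h₀, Finset.mem_filter.2 ⟨hh₀, ?_, ?_⟩⟩⟩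
  · omega
  · have e : ((((p : ℤ) - h₀).toNat : ℕ) : ℤ) + h₀ = (p : ℤ) := by omega
    rw [e, Int.toNat_natCast]
    exact hprime

/-- **Polymath 8b, Theorem 3.8** in `DHL` language (Maynard's theorem, Maynard 2015 Prop. 4.2):
if the primes have level `θ > 0` and some admissible `F` on `R_k` has Maynard functional `> 2m/θ`,
then `DHL[k, m+1]`; immediate from the named fact `frequently_card_primes_ge_of_maynardFunctional`.
[cite: Polymath8b2014, Theorem 3.8] -/
theorem weakDHL_of_maynardFunctional_gt (h : frequently_card_primes_ge_of_maynardFunctional)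
    {θ : ℝ} (hθ0 : 0 < θ) (hθ : PrimesHaveLevel θ) {m k : ℕ} {F : (Fin k → ℝ) → ℝ}
    (hF : IsMaynardAdmissible k F) (hM : 2 * (m : ℝ) / θ < maynardFunctional k F) :
    WeakDicksonHardyLittlewood k (m + 1) :=
  fun H hH hk => h θ hθ0 hθ m k F hF hM H hH hk

/-! ### From `DHL[k, m+1]` to gaps between primes -/

/-- The counting step behind "`DHL[k, m+1]` implies `H_m ≤ H(k)`" (Polymath 8b, p. 8): a finite set
`P` of at least `m + 1` primes, any two of which differ by at most `d`, produces an index `j` with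
`p_j = min P` and `p_{j+m} ≤ p_j + d`. [cite: Polymath8b2014, §3, remark after Claim 3.1] -/
theorem exists_nth_prime_add_le_of_card {P : Finset ℕ} (hP : ∀ q ∈ P, q.Prime) {m d : ℕ}
    (hm : m + 1 ≤ #P) (hd : ∀ a ∈ P, ∀ b ∈ P, b ≤ a + d) :
    ∃ j, Nat.nth Nat.Prime j ∈ P ∧ Nat.nth Nat.Prime (j + m) ≤ Nat.nth Nat.Prime j + d := by
  have hne : P.Nonempty := Finset.card_pos.1 (by omega)
  have haP : P.min' hne ∈ P := P.min'_mem hne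
  have hbP : P.max' hne ∈ P := P.max'_mem hne
  have hab : P.min' hne ≤ P.max' hne := P.min'_le _ hbP
  refine ⟨Nat.count Nat.Prime (P.min' hne), ?_, ?_⟩
  · rw [Nat.nth_count (hP _ haP)]
    exact haP
  · rw [Nat.nth_count (hP _ haP)]
    have hcount : Nat.count Nat.Prime (P.min' hne) + #P ≤ Nat.count Nat.Prime (P.max' hne + 1) := by
      rw [Nat.count_eq_card_filter_range, Nat.count_eq_card_filter_range,
        ← Finset.card_union_of_disjoint]
      · refine Finset.card_le_card fun q hq => ?_
        rw [Finset.mem_filter, Finset.mem_range]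
        rcases Finset.mem_union.1 hq with hq | hq
        · rw [Finset.mem_filter, Finset.mem_range] at hq
          exact ⟨by omega, hq.2⟩
        · exact ⟨Nat.lt_succ_of_le (P.le_max' q hq), hP q hq⟩
      · exact Finset.disjoint_left.2 fun q hq hqP =>
          (not_le.2 (Finset.mem_range.1 (Finset.mem_filter.1 hq).1)) (P.min'_le q hqP)
    have hlt := Nat.nth_lt_of_lt_count
      (show Nat.count Nat.Prime (P.min' hne) + m < Nat.count Nat.Prime (P.max' hne + 1) by omega)
    have hba : P.max' hne ≤ P.min' hne + d := hd _ haP _ hbP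
    omega

/-- **`DHL[k, m+1]` implies `H_m ≤ H(k)`** (Polymath 8b, p. 8, the remark after Claim 3.1), in the
`liminf`-free form of parity.S13: if `DHL[k, m+1]` holds and `H` is an admissible `k`-tuple all of whose
differences are `≤ d`, then `p_{n+m} ≤ p_n + d` for infinitely many `n`.  Proof: a translate `n + H`
with `m + 1` primes `q₀ < ⋯` gives `q₀ = p_j` and `p_{j+m} ≤ max ≤ p_j + d`
(`exists_nth_prime_add_le_of_card`), and `j → ∞` as `n → ∞`. [cite: Polymath8b2014, §3, remark after Claim 3.1] -/
theorem WeakDicksonHardyLittlewood.frequently_nth_prime_add_le {k m : ℕ}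
    (hDHL : WeakDicksonHardyLittlewood k (m + 1)) {H : Finset ℤ} (hH : IsAdmissibleTuple H)
    (hk : H.card = k) {d : ℕ} (hd : ∀ a ∈ H, ∀ b ∈ H, b - a ≤ (d : ℤ)) :
    ∃ᶠ n in atTop, Nat.nth Nat.Prime (n + m) ≤ Nat.nth Nat.Prime n + d := by
  rw [Filter.frequently_atTop]
  intro N
  obtain ⟨n, hn, hcard⟩ :=
    Filter.frequently_atTop.1 (hDHL H hH hk) (Nat.nth Nat.Prime N + 1 + ∑ h ∈ H, h.natAbs)
  -- the primes among `n + h`, `h ∈ H`, as natural numbers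
  set S : Finset ℤ := H.filter fun h ↦ 0 < (n : ℤ) + h ∧ ((n : ℤ) + h).toNat.Prime with hS
  set f : ℤ → ℕ := fun h => ((n : ℤ) + h).toNat with hf
  have hinj : Set.InjOn f S := by
    intro h₁ hh₁ h₂ hh₂ heq
    have h1 := (Finset.mem_filter.1 (Finset.mem_coe.1 hh₁)).2.1
    have h2 := (Finset.mem_filter.1 (Finset.mem_coe.1 hh₂)).2.1
    simp only [hf] at heq
    omega
  have hPprime : ∀ q ∈ S.image f, q.Prime := by
    intro q hq
    obtain ⟨h, hh, rfl⟩ := Finset.mem_image.1 hq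
    exact (Finset.mem_filter.1 hh).2.2
  have hPd : ∀ a ∈ S.image f, ∀ b ∈ S.image f, b ≤ a + d := by
    intro a ha b hb
    obtain ⟨a', ha', rfl⟩ := Finset.mem_image.1 ha
    obtain ⟨b', hb', rfl⟩ := Finset.mem_image.1 hb
    have h1 := Finset.mem_filter.1 ha'
    have h2 := Finset.mem_filter.1 hb'
    have h3 := hd a' h1.1 b' h2.1
    simp only [hf]
    omega
  have hcardP : m + 1 ≤ #(S.image f) := by rwa [Finset.card_image_of_injOn hinj]
  obtain ⟨j, hjP, hj⟩ := exists_nth_prime_add_le_of_card hPprime hcardP hPd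
  refine ⟨j, ?_, hj⟩
  obtain ⟨h, hh, hjh⟩ := Finset.mem_image.1 hjP
  have hhH : h ∈ H := (Finset.mem_filter.1 hh).1
  have hpos : 0 < (n : ℤ) + h := (Finset.mem_filter.1 hh).2.1
  have hTh : h.natAbs ≤ ∑ h ∈ H, h.natAbs :=
    Finset.single_le_sum (f := fun h : ℤ => h.natAbs) (fun _ _ => Nat.zero_le _) hhH
  have hlt : Nat.nth Nat.Prime N < Nat.nth Nat.Prime j := by
    rw [← hjh]
    simp only [hf]
    omega
  exact ((Nat.nth_lt_nth Nat.infinite_setOf_prime).1 hlt).le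

/-! ### A narrow admissible 50-tuple: `H(50) ≤ 246` -/

/-- An admissible 50-tuple of diameter `246`, witnessing `H(50) ≤ 246` (Polymath 8b, Theorem 3.3(i);
displayed in §10.1, p. 39, as the tuple realising `H(50) = 246` after Clark–Jarvis, and reproduced in
Granville, *Primes in intervals of bounded length*, Bull. AMS 52 (2015), arXiv:1410.8400, p. 6:
"The narrowest 50-tuple has width 246 and one such tuple is: 0, 4, 6, 16, …, 244, 246").
[cite: Polymath8b2014, Theorem 3.3(i) and §10.1][cite: Granville2014, p. 6] -/
def narrowTuple50 : Finset ℤ :=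
  {0, 4, 6, 16, 30, 34, 36, 46, 48, 58, 60, 64, 70, 78, 84, 88, 90, 94, 100, 106, 108, 114, 118,
    126, 130, 136, 144, 148, 150, 156, 160, 168, 174, 178, 184, 190, 196, 198, 204, 210, 214, 216,
    220, 226, 228, 234, 238, 240, 244, 246}

/-- `narrowTuple50` has 50 elements (Polymath 8b, §10.1; Granville 2015, p. 6). [cite: Polymath8b2014, §10.1] -/
theorem card_narrowTuple50 : narrowTuple50.card = 50 := by
  decide +kernel

/-- `narrowTuple50 ⊆ [0, 246]`, so its diameter is `≤ 246` (Polymath 8b, Thm 3.3(i)). [cite: Polymath8b2014, Theorem 3.3(i)] -/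
theorem narrowTuple50_mem_Icc : ∀ h ∈ narrowTuple50, (0 : ℤ) ≤ h ∧ h ≤ 246 := by
  decide +kernel

/-- For every `2 ≤ p ≤ 50` the tuple `narrowTuple50` misses some residue class `r (p)`; a kernel
computation (Polymath 8b §10.2.1, admissibility testing modulo the primes `p ≤ k`). [cite: Polymath8b2014, §10.1 and §10.2.1] -/
theorem narrowTuple50_exists_forall_not_dvd :
    ∀ p ∈ Finset.Icc 2 50, ∃ r ∈ Finset.range p, ∀ h ∈ narrowTuple50, ¬((p : ℤ) ∣ h - r) := by
  decide +kernel

/-- If a tuple `H` misses the residue class `r (p)`, then `ν_H(p) < p` (Polymath 8b §10.2.1: "`H` is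
admissible modulo `p` if its elements do not form a complete set of residues modulo `p`"). [cite: Polymath8b2014, §10.2.1] -/
theorem tupleResidueCount_lt_of_forall_not_dvd {H : Finset ℤ} {p : ℕ} (hp : 0 < p) {r : ℤ}
    (hr : ∀ h ∈ H, ¬((p : ℤ) ∣ h - r)) : tupleResidueCount H p < p := by
  haveI : NeZero p := ⟨hp.ne'⟩
  have hmem : ((r : ℤ) : ZMod p) ∉ H.image fun h : ℤ => (h : ZMod p) := by
    intro hin
    obtain ⟨h, hh, heq⟩ := Finset.mem_image.1 hin
    exact hr h hh ((ZMod.intCast_eq_intCast_iff_dvd_sub r h p).1 heq.symm)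
  simpa only [tupleResidueCount, ZMod.card] using Finset.card_lt_univ_of_notMem hmem

/-- **Polymath 8b, Theorem 3.3(i)** (upper bound): `narrowTuple50` is admissible, hence
`H(50) ≤ 246`. Only primes `p ≤ 50` need checking (`isAdmissibleTuple_iff_of_le_card`). [cite: Polymath8b2014, Theorem 3.3(i)] -/
theorem isAdmissibleTuple_narrowTuple50 : IsAdmissibleTuple narrowTuple50 := by
  rw [isAdmissibleTuple_iff_of_le_card, card_narrowTuple50]
  intro p hp hle
  obtain ⟨r, -, hr⟩ := narrowTuple50_exists_forall_not_dvd p (Finset.mem_Icc.2 ⟨hp.two_le, hle⟩)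
  exact tupleResidueCount_lt_of_forall_not_dvd hp.pos hr

/-- **Thm 3.2(i) ⟹ Thm 1.4(i)**: `DHL[50, 2]` implies `liminf (p_{n+1} - p_n) ≤ 246`
(Polymath 8b, p. 8, via `H(50) ≤ 246`). [cite: Polymath8b2014, Theorem 1.4(i) (deduction on p. 8)] -/
theorem frequently_nth_prime_succ_le_add_polymath_of_weakDHL
    (h : WeakDicksonHardyLittlewood 50 2) : Sieve.frequently_nth_prime_succ_le_add_polymath :=
  h.frequently_nth_prime_add_le (m := 1) isAdmissibleTuple_narrowTuple50 card_narrowTuple50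
    (d := 246) fun a ha b hb => by
      have h1 := narrowTuple50_mem_Icc a ha
      have h2 := narrowTuple50_mem_Icc b hb
      push_cast
      omega

/-! ### The `ε`-enlarged simplex and the functionals of Theorem 3.12 -/

/-- The scaled simplex `r • R_k = {t ∈ [0,+∞)^k | t₁ + ⋯ + t_k ≤ r}` (Polymath 8b, Thm 3.12:
`(1+ε) • R_k` and `(1-ε) • R_{k-1}`); `scaledSimplex k 1 = maynardSimplex k`. [cite: Polymath8b2014, Theorem 3.12] -/
def scaledSimplex (k : ℕ) (r : ℝ) : Set (Fin k → ℝ) :=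
  {t | (∀ i, 0 ≤ t i) ∧ ∑ i, t i ≤ r}

/-- `1 • R_k` is Maynard's simplex `R_k`. [cite: Polymath8b2014, Theorem 3.8] -/
@[simp] theorem scaledSimplex_one (k : ℕ) : scaledSimplex k 1 = maynardSimplex k := rfl

/-- `r • R_k ⊆ s • R_k` for `r ≤ s`. [folklore] -/
theorem scaledSimplex_mono (k : ℕ) {r s : ℝ} (h : r ≤ s) : scaledSimplex k r ⊆ scaledSimplex k s :=
  fun _ ht => ⟨ht.1, ht.2.trans h⟩

/-- The orthant `[0,+∞)^k` (the domain of the test functions in print) is closed. [folklore] -/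
theorem isClosed_orthant (k : ℕ) : IsClosed {t : Fin k → ℝ | ∀ i, 0 ≤ t i} := by
  simpa only [Set.setOf_forall] using
    isClosed_iInter fun i => isClosed_le continuous_const (continuous_apply i)

/-- `r • R_k` is closed. [folklore] -/
theorem isClosed_scaledSimplex (k : ℕ) (r : ℝ) : IsClosed (scaledSimplex k r) := by
  have h2 : IsClosed {t : Fin k → ℝ | ∑ i, t i ≤ r} :=
    isClosed_le (continuous_finsetSum _ fun i _ => continuous_apply i) continuous_const
  simpa [scaledSimplex, Set.setOf_and] using (isClosed_orthant k).inter h2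

/-- `r • R_k` is Lebesgue measurable. [folklore] -/
theorem measurableSet_scaledSimplex (k : ℕ) (r : ℝ) : MeasurableSet (scaledSimplex k r) :=
  (isClosed_scaledSimplex k r).measurableSet

/-- `I(F) = ∫_{[0,+∞)^k} F(t₁, …, t_k)² dt₁ ⋯ dt_k`, the denominator of `M_k` and `M_{k,ε}` (Polymath 8b,
Theorem 3.8, definition of `I(F)`; reused verbatim in Theorem 3.12). The integral is over the orthant
`[0,+∞)^k`, the domain of `F` in print. [cite: Polymath8b2014, Theorem 3.8, definition of I(F)] -/
def polymathI (k : ℕ) (F : (Fin k → ℝ) → ℝ) : ℝ :=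
  ∫ t in {t : Fin k → ℝ | ∀ i, 0 ≤ t i}, F t ^ 2

/-- `I(F) ≥ 0`. [folklore] -/
theorem polymathI_nonneg (k : ℕ) (F : (Fin k → ℝ) → ℝ) : 0 ≤ polymathI k F :=
  integral_nonneg fun _ => sq_nonneg _

/-- The region of integration realising `J_{i,r}` on `Fin k → ℝ`: the dummy coordinate `t_i` ranges over
`[0, 1]` (a fibre of length `1`) and `(t_j)_{j ≠ i}` over `r • R_{k-1}` (Polymath 8b, Thm 3.12; see the
module docstring). [cite: Polymath8b2014, Theorem 3.12, definition of J_{i,1-ε}] -/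
def polymathJRegion (k : ℕ) (r : ℝ) (i : Fin k) : Set (Fin k → ℝ) :=
  {t | t i ≤ 1 ∧ (∀ j, 0 ≤ t j) ∧ ∑ j ∈ univ.erase i, t j ≤ r}

/-- `J_{i,r}(F) = ∫_{r • R_{k-1}} (∫₀^∞ F(t₁, …, t_k) dt_i)² dt₁ ⋯ dt_{i-1} dt_{i+1} ⋯ dt_k`
(Polymath 8b, Thm 3.12, with `r = 1 - ε`; §5.3 also uses `r = (1-ε)θ/2`).  Implemented as the
integral over `polymathJRegion k r i` of `t ↦ (∫_{u > 0} F(t with t_i := u) du)²`; the integrand is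
constant in `t_i ∈ [0, 1]`, so this equals the printed `(k-1)`-fold integral. [cite: Polymath8b2014, Theorem 3.12, definition of J_{i,1-ε}] -/
def polymathJ (k : ℕ) (r : ℝ) (i : Fin k) (F : (Fin k → ℝ) → ℝ) : ℝ :=
  ∫ t in polymathJRegion k r i, (∫ u in Set.Ioi (0 : ℝ), F (Function.update t i u)) ^ 2

/-- `J_{i,r}(F) ≥ 0`. [folklore] -/
theorem polymathJ_nonneg (k : ℕ) (r : ℝ) (i : Fin k) (F : (Fin k → ℝ) → ℝ) :
    0 ≤ polymathJ k r i F :=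
  integral_nonneg fun _ => sq_nonneg _

/-- The ratio `(∑_{i=1}^k J_{i,1-ε}(F)) / I(F)` whose supremum is `M_{k,ε}` (Polymath 8b, Thm 3.12).
Junk value `0` when `I(F) = 0`. [cite: Polymath8b2014, Theorem 3.12, definition of M_{k,ε}] -/
def polymathFunctional (k : ℕ) (ε : ℝ) (F : (Fin k → ℝ) → ℝ) : ℝ :=
  (∑ i, polymathJ k (1 - ε) i F) / polymathI k F

/-- The functional of Thm 3.12 is nonnegative. [folklore] -/
theorem polymathFunctional_nonneg (k : ℕ) (ε : ℝ) (F : (Fin k → ℝ) → ℝ) :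
    0 ≤ polymathFunctional k ε F :=
  div_nonneg (Finset.sum_nonneg fun i _ => polymathJ_nonneg k _ i F) (polymathI_nonneg k F)

/-- The test functions of `M_{k,ε}` (Polymath 8b, Thm 3.12): square-integrable `F` supported on
`(1+ε) • R_k` and not almost everywhere zero; rendered as: `F` measurable, `support F ⊆ (1+ε) • R_k`,
`F²` integrable on `(1+ε) • R_k`, `I(F) > 0` (cf. `IsMaynardAdmissible`). [cite: Polymath8b2014, Theorem 3.12] -/
structure IsPolymathTestFunction (k : ℕ) (ε : ℝ) (F : (Fin k → ℝ) → ℝ) : Prop where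
  /-- `F` is (Borel/Lebesgue) measurable. -/
  measurable : Measurable F
  /-- `F` vanishes outside the enlarged simplex `(1+ε) • R_k`. -/
  support_subset : Function.support F ⊆ scaledSimplex k (1 + ε)
  /-- `F` is square-integrable on `(1+ε) • R_k`. -/
  integrableOn_sq : IntegrableOn (fun t => F t ^ 2) (scaledSimplex k (1 + ε))
  /-- `I(F) > 0`, i.e. `F` is not a.e. zero. -/
  polymathI_pos : 0 < polymathI k F

/-- `M_{k,ε} = sup_F (∑ᵢ J_{i,1-ε}(F)) / I(F)` over the test functions of Thm 3.12 (Polymath 8b, p. 11).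
DEFINITION ONLY: a bare `sSup` over `ℝ` (junk value `0` if the set were empty or unbounded above); the
theorems below are stated `sSup`-free through explicit test functions. [cite: Polymath8b2014, Theorem 3.12, definition of M_{k,ε}] -/
def polymathM (k : ℕ) (ε : ℝ) : ℝ :=
  sSup {M | ∃ F, IsPolymathTestFunction k ε F ∧ M = polymathFunctional k ε F}

/-- Remark form of the definition of `M_{k,ε}`: a test function bounds `M_{k,ε}` from below, provided
the defining set is bounded above. [folklore] -/
theorem le_polymathM {k : ℕ} {ε : ℝ} {F : (Fin k → ℝ) → ℝ}
    (hb : BddAbove {M | ∃ F, IsPolymathTestFunction k ε F ∧ M = polymathFunctional k ε F})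
    (hF : IsPolymathTestFunction k ε F) : polymathFunctional k ε F ≤ polymathM k ε :=
  le_csSup hb ⟨F, hF, rfl⟩

/-- For `F` supported on `r • R_k`, `I(F)` is the integral of `F²` over `r • R_k`. [folklore] -/
theorem polymathI_eq_setIntegral_of_support_subset {k : ℕ} {r : ℝ} {F : (Fin k → ℝ) → ℝ}
    (hF : Function.support F ⊆ scaledSimplex k r) :
    polymathI k F = ∫ t in scaledSimplex k r, F t ^ 2 := by
  refine setIntegral_eq_of_subset_of_forall_sdiff_eq_zero (isClosed_orthant k).measurableSet
    (fun t ht => ht.1) fun t ht => ?_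
  have h0 : F t = 0 := by
    by_contra h
    exact ht.2 (hF h)
  simp [h0]

/-- Consistency with `MaynardTao.lean`: a Maynard-admissible `F` (supported on `R_k = 1 • R_k`) is a
test function for `M_{k,ε}` for every `ε ≥ 0`, and `I(F) = I_k(F)` (Polymath 8b, p. 11: `M_{k,ε}`
enlarges the class of Thm 3.8). [cite: Polymath8b2014, Theorem 3.12] -/
theorem IsMaynardAdmissible.isPolymathTestFunction {k : ℕ} {F : (Fin k → ℝ) → ℝ}
    (hF : IsMaynardAdmissible k F) {ε : ℝ} (hε : 0 ≤ ε) : IsPolymathTestFunction k ε F where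
  measurable := hF.measurable
  support_subset := hF.support_subset.trans
    ((scaledSimplex_one k).symm ▸ scaledSimplex_mono k (by linarith))
  integrableOn_sq := hF.integrableOn_sq.of_forall_sdiff_eq_zero (measurableSet_scaledSimplex k _)
    fun t ht => by
      have h0 : F t = 0 := by
        by_contra h
        exact ht.2 (hF.support_subset h)
      simp [h0]
  polymathI_pos := by
    rw [polymathI_eq_setIntegral_of_support_subset (r := 1) hF.support_subset]
    exact hF.maynardI_pos

/-! ### Named facts: Theorem 3.12(i) and Theorem 3.13(i) -/

/-- **Polymath 8b, Theorem 3.12(i)** (sieving on an `ε`-enlarged simplex, `EH` case; proved in §5.3,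
pp. 21–23, from the sieve asymptotics Thms 3.5–3.6 and Lemma 3.4).  Let `k ≥ 2`, `m ≥ 1` and
`0 < ε < 1` be fixed.  If `EH[θ]` holds for some fixed `0 < θ < 1` with `1 + ε < 1/θ`, and
`M_{k,ε} > 2m/θ`, then `DHL[k, m+1]`.  Rendering (module docstring): `EH[θ]` as `PrimesHaveLevel θ`,
`M_{k,ε} > 2m/θ` as a test function `F` with `(∑ᵢ J_{i,1-ε}(F))/I(F) > 2m/θ`; both printed conditions
are open in `θ`, so this follows from the printed statement at a slightly smaller `θ`.  A deep theorem
(the multidimensional Selberg sieve of §4), NOT proved here. [cite: Polymath8b2014, Theorem 3.12(i)] -/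
def weakDHL_of_polymathFunctional_gt : Prop :=
  ∀ (k m : ℕ), 2 ≤ k → 1 ≤ m → ∀ (ε : ℝ), 0 < ε → ε < 1 → ∀ (θ : ℝ), 0 < θ → θ < 1 →
    PrimesHaveLevel θ → 1 + ε < 1 / θ → ∀ (F : (Fin k → ℝ) → ℝ), IsPolymathTestFunction k ε F →
    2 * (m : ℝ) / θ < polymathFunctional k ε F → WeakDicksonHardyLittlewood k (m + 1)

/-- **Polymath 8b, Theorem 3.13(i)**: `M_{50,1/25} > 4.0043`, i.e. some test function `F` on
`(1 + 1/25) • R_50` has `(∑ᵢ J_{i,24/25}(F)) / I(F) > 4.0043` (established numerically in §7.2, p. 31,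
with symmetric polynomials of degree `d = 27` times the indicator of the enlarged simplex; a
computer-assisted bound, NOT verified here). [cite: Polymath8b2014, Theorem 3.13(i)] -/
def exists_polymathFunctional_fifty_gt : Prop :=
  ∃ F : (Fin 50 → ℝ) → ℝ, IsPolymathTestFunction 50 (1 / 25) F ∧
    (4.0043 : ℝ) < polymathFunctional 50 (1 / 25) F

/-! ### Assembly: Theorem 3.2(i) and Theorem 1.4(i) from the leaves -/

/-- **Polymath 8b, Theorem 3.2(i)** (`DHL[50, 2]`) from its printed ingredients: Bombieri–Vinogradov
(Thm 2.3, as `BombieriVinogradovStatement`), Thm 3.12(i) and Thm 3.13(i), with `θ = 0.4996 < 1/2`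
(`1 + 1/25 = 1.04 < 1/θ` and `2/θ = 4.0032… < 4.0043`; p. 11). [cite: Polymath8b2014, Theorem 3.2(i)] -/
theorem weakDHL_fifty_two (hBV : BombieriVinogradovStatement)
    (h312 : weakDHL_of_polymathFunctional_gt) (h313 : exists_polymathFunctional_fifty_gt) :
    WeakDicksonHardyLittlewood 50 2 := by
  obtain ⟨F, hF, hM⟩ := h313
  have hθ : PrimesHaveLevel (0.4996 : ℝ) := hBV _ (by norm_num)
  exact h312 50 1 (by norm_num) le_rfl (1 / 25) (by norm_num) (by norm_num) 0.4996 (by norm_num)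
    (by norm_num) hθ (by norm_num) F hF (lt_trans (by norm_num) hM)

/-- **Polymath 8b, Theorem 1.4(i)** (`liminf (p_{n+1} - p_n) ≤ 246`, parity.S13) reduced to its three
leaves: the Bombieri–Vinogradov theorem (`BombieriVinogradovStatement`), the `ε`-enlarged sieve
Thm 3.12(i) (`weakDHL_of_polymathFunctional_gt`) and the numerical Thm 3.13(i)
(`exists_polymathFunctional_fifty_gt`); the tuple (Thm 3.3(i)) and the deductions on pp. 8 and 11 are
proved above. [cite: Polymath8b2014, Theorem 1.4(i)] -/
theorem frequently_nth_prime_succ_le_add_polymath_of_bombieriVinogradovStatement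
    (hBV : BombieriVinogradovStatement) (h312 : weakDHL_of_polymathFunctional_gt)
    (h313 : exists_polymathFunctional_fifty_gt) :
    Sieve.frequently_nth_prime_succ_le_add_polymath :=
  Sieve.frequently_nth_prime_succ_le_add_polymath_of_weakDHL (weakDHL_fifty_two hBV h312 h313)

end Literature.NumberTheory.Sieve
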